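import Summits.ABC.IUTFork.Thm311RealInd1StripPacketMonomialFloorForms
import Summits.ABC.IUTFork.Thm311RealInd1StripPacketUnionJunctionBit
import HarnessLib

/-!
# [IUTchIII] Thm 3.11 (i) (Ind1)+(Ind2) ⟶ Cor 3.12 Step (x): PORTS of the NO-BIT / ONE-BIT forms of the monomial-floor junction (R25 (A′)) to the
# `ln ν̄_{𝕃_p}` level of reading (P) (over p552192 §3) and to the slot-UNION region of reading (U) at the packet and place-section levels (over p553751 §1–§2)
# (modulo `JannsenWingbergMappingClass`; nothing new claimed)

PROOF-ONLY file (abc-iut cell, Cor. 3.12 sub-crew, seat abc-iut-c312-1 = holder of record of the typed [IUTchIII] Thm. 3.11, gen 19; row «R26 = C:ROOM-SHARPNESS»,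
KEY ROOMSHARP, C LEAD ruling C-R171 (a); file (ι)).  TAKES NO SIDE on [IUTchIII] Cor. 3.12.  No definition, no `Prop` fact; `JannsenWingbergMappingClass` the only
conditional input (`hMC`), exactly where R25 (A′) carries it.  Every theorem is the assembly of p552192 §3 / p553751 §1–§2 VERBATIM with the bit family replaced
by the ROOM INEQUALITY of R25 (A′) (`…_eq_of_room_…`: `(r+2)/e_{i₀} + Σ_{i≠i₀} 1/e_i ≤ 1`, NO bit, NO residue hypothesis) or by its ONE-BIT form
(`…_eq_of_oneBit_…`: `(r+1)/e_{i₀} + Σ_{i≠b} 1/e_i ≤ 1`, one bit at the chosen factor `b`).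
* §1 reading (P), `ln ν̄` level: **`localFields_lnνLp_hull_orbitH_eq_negLogThetaPerImageAt_of_room_…`** / **`…_of_oneBit_…`** —
  `ln ν̄_{𝕃_p}(v⃗ ↦ hull(H-orbit of O_𝕃(−P_Θ)_{v⃗})) = −|log(Θ)|^{(P)}_p` under a per-collection room family (resp. one-bit family at chosen factors `b(i,v⃗)`).
* §2 reading (U), packet and place-section levels: **`packetHull_iUnion_image_iUnion_iota_smul_normalizedPacket_eq_of_room_…`** (slot union `⋃_a ι_a(g_a)·(R_I)^∼`,
  content-minimising slot `a₀`, the room inequality AT `a₀`; upper bound p545184 `TameContent`, lower bound R25 (A′) §1 at `a₀`) and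
  **`localFields_packetHull_orbitH_indOneUnion_pilotRegion_eq_possibleImagesHull_of_room_…`**.  (The `ln ν̄`-level and input-level ports of reading (U) are the same
  assembly over p553751 §3–§4; not repeated here for the 400-line rule.)
HONEST SCOPE as R25 (A′): OUR typings; conditional on `hMC`; EVEN degree, WILD, `p = 2` remain; nothing here decides any bit; equal-AS-TYPED ≠ equal in print; nothing
here asserts that abc is proved or refuted; no side taken on [IUTchIII] Cor. 3.12 / [IUTchIV] Thm. 1.10, on (U) vs (P), or on any author. [claim: Mochizuki2012, status: disputed];
[cite: Mochizuki2012, IUTchIII Thm. 3.11 (i) p. 154; Cor. 3.12 p. 174, Step (x)/(xi) pp. 181–183; IUTchIV Prop. 1.2 (ii) pp. 10–11];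
[cite: Kondo2025OuterAutMLF, §3 Thm 3.17, Rem 3.18]; [cite: DupuyHilado2025, §4.7, §4.9, §4.11, §4.12]. typed ≠ proved; a conditional theorem discharges nothing it binds.
-/

set_option autoImplicit false

noncomputable section

open Metric Set Function
open scoped Pointwise TensorProduct

namespace Summit.ABC.IUTFork.Thm311.Real

open NumberField IsDedekindDomain Literature.NumberTheory.NumberFields Literature.IUT.LogVolume
open Literature.NumberTheory.GaloisRepresentations Literature.NumberTheory.GaloisRepresentations.Ultrametric
open Literature.AnabelianGeometry.AbsoluteAnabelian Literature.IUT.HodgeArakelov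
open Literature.IUT.HodgeArakelov.AbsTopMonoids

/-! ## §2a Reading (U), packet level: the slot union under the room inequality at the minimising slot -/

section GenuineFactors

variable {K : Type} [Field K] [NumberField K] (p : ℕ) [hp : Fact p.Prime]
variable {I : Type} [Fintype I] [DecidableEq I] (w : I → HeightOneSpectrum (𝓞 K)) (hw : ∀ i, ((p : ℕ) : 𝓞 K) ∈ (w i).asIdeal)

/-- **THE UNION JUNCTION at the packet under the ROOM INEQUALITY at the minimising slot, NO bit (modulo `JannsenWingbergMappingClass`).**  Setting of p553751 §1
(every factor TAME of ODD local degree `≥ 3`, slot twists `‖g_a‖ = p^{−v_a/e_a}`, content-minimising slot `a₀`, `H ≤ indTwo` containing the single-factor strip moves);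
the bit family REPLACED by R25 (A′) §1's room inequality at `a₀`: `((v_{a₀} − 1) % e_{a₀} + 2)/e_{a₀} + Σ_{i≠a₀} 1/e_i ≤ 1`.  Conclusion unchanged:
`packetHull(⋃_{γ∈H} γ(⋃_a ι_a(g_a)·(R_I)^∼)) = packetHull(p^{min_a A_a}·log_p(R_I^×))` (upper: p545184; lower: R25 (A′) §1 at the slot `a₀`).
[claim: Mochizuki2012, status: disputed] [cite: Mochizuki2012, IUTchIII Thm. 3.11 (i) p. 154; Cor. 3.12 p. 174; IUTchIV Prop. 1.2 (ii) p. 10–11]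
[cite: Kondo2025OuterAutMLF, §3 Thm 3.17, Rem 3.18] [cite: DupuyHilado2025, §4.7, §4.9, §4.12] -/
theorem packetHull_iUnion_image_iUnion_iota_smul_normalizedPacket_eq_of_room_of_jannsenWingbergMappingClass [Nonempty I]
    (hMC : JannsenWingbergMappingClass) (hp2 : 2 < p)
    (he : ∀ i, absRamificationIdx p (RescaledCompletion K p (w i) (hw i)) ≤ p - 2)
    (h3 : ∀ i, 3 ≤ localDeg K (w i)) (hodd : ∀ i, Odd (localDeg K (w i)))
    (g : Π i, RescaledCompletion K p (w i) (hw i)) (v : I → ℤ)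
    (hg : ∀ i, ‖g i‖ = (p : ℝ) ^ (-(v i / (absRamificationIdx p (RescaledCompletion K p (w i) (hw i)) : ℝ))))
    (a₀ : I)
    (ha₀ : ∀ a, (v a₀ - 1) / (absRamificationIdx p (RescaledCompletion K p (w a₀) (hw a₀)) : ℤ) ≤
      (v a - 1) / (absRamificationIdx p (RescaledCompletion K p (w a) (hw a)) : ℤ))
    (hroom : (((v a₀ - 1) % (absRamificationIdx p (RescaledCompletion K p (w a₀) (hw a₀)) : ℤ) + 2 : ℤ) : ℝ) /
        (absRamificationIdx p (RescaledCompletion K p (w a₀) (hw a₀)) : ℝ) +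
      ∑ i ∈ Finset.univ.erase a₀, (1 : ℝ) / (absRamificationIdx p (RescaledCompletion K p (w i) (hw i)) : ℝ) ≤ 1)
    (H : Subgroup (PacketAlgebra p (fun i => RescaledCompletion K p (w i) (hw i)) ≃ₗ[ℚ_[p]]
      PacketAlgebra p (fun i => RescaledCompletion K p (w i) (hw i))))
    (hH : H ≤ indTwo p (fun i => RescaledCompletion K p (w i) (hw i)))
    (hstrip : ∀ (i₁ : I), ∀ ψ ∈ ind1StripOf (w i₁) (galoisLog (w i₁)), ∃ γ ∈ H,
      ∀ z : Π i, RescaledCompletion K p (w i) (hw i),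
        (γ : PacketAlgebra p (fun i => RescaledCompletion K p (w i) (hw i)) ≃ₗ[ℚ_[p]]
            PacketAlgebra p (fun i => RescaledCompletion K p (w i) (hw i))) (PiTensorProduct.tprod ℚ_[p] z) =
          PiTensorProduct.tprod ℚ_[p] (update z i₁ (RescaledCompletion.of K p (w i₁) (hw i₁)
            (ψ ((RescaledCompletion.of K p (w i₁) (hw i₁)).symm (z i₁)))))) :
    packetHull p (fun i => RescaledCompletion K p (w i) (hw i))
        (⋃ γ : H, (γ : PacketAlgebra p (fun i => RescaledCompletion K p (w i) (hw i)) ≃ₗ[ℚ_[p]]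
            PacketAlgebra p (fun i => RescaledCompletion K p (w i) (hw i))) ''
          ⋃ a, iota p (fun i => RescaledCompletion K p (w i) (hw i)) a (g a) •
            (normalizedPacket p (fun i => RescaledCompletion K p (w i) (hw i)) :
              Set (PacketAlgebra p (fun i => RescaledCompletion K p (w i) (hw i))))) =
      packetHull p (fun i => RescaledCompletion K p (w i) (hw i))
        (((p : ℚ_[p]) ^ (Finset.univ.inf' Finset.univ_nonempty
            (fun a => (v a - 1) / (absRamificationIdx p (RescaledCompletion K p (w a) (hw a)) : ℤ) + 1 - Fintype.card I))) •
          (logPacket p (fun i => RescaledCompletion K p (w i) (hw i)) :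
            Set (PacketAlgebra p (fun i => RescaledCompletion K p (w i) (hw i))))) := by
  set k := fun i => RescaledCompletion K p (w i) (hw i) with hk
  set A : I → ℤ := fun a => (v a - 1) / (absRamificationIdx p (k a) : ℤ) + 1 - Fintype.card I with hA
  obtain ⟨hsub, -⟩ := TameContent.content_iUnion_iota_smul_normalizedPacket p k hp2 he g v hg
  refine Set.Subset.antisymm (packetHull_iUnion_image_subset_of_subset_smul_logPacket p k hsub H hH) ?_
  have hmin : Finset.univ.inf' Finset.univ_nonempty A = A a₀ :=
    le_antisymm (Finset.inf'_le A (Finset.mem_univ a₀))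
      (Finset.le_inf' Finset.univ_nonempty A fun a _ => by
        have := ha₀ a
        simp only [hA]
        linarith)
  have hcore := packetHull_iUnion_image_iota_smul_normalizedPacket_eq_of_room_of_jannsenWingbergMappingClass p w hw hMC hp2 he h3
    hodd a₀ (hg a₀) hroom H hH hstrip
  change packetHull p k (((p : ℚ_[p]) ^ (Finset.univ.inf' Finset.univ_nonempty A)) • (logPacket p k : Set (PacketAlgebra p k))) ⊆ _
  rw [hmin, ← hcore]
  refine packetHull_mono p k (Set.iUnion_mono fun γ => Set.image_mono ?_)
  exact Set.subset_iUnion (fun a => iota p k a (g a) • (normalizedPacket p k : Set (PacketAlgebra p k))) a₀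

end GenuineFactors

section PlaceSection

variable {F₀ : Type} [Field F₀] [NumberField F₀] {K : Type} [Field K] [NumberField K] [Algebra F₀ K]
variable (σ : PlaceSection F₀ K) (p : ℕ) [hp : Fact p.Prime]
variable (c : (j : ℕ) → (Fin (j + 1) → placesOver F₀ p) → ℚ_[p]) (hc0 : ∀ j e, c j e ≠ 0)
  (hcσ : ∀ (j : ℕ) (τ : Equiv.Perm (Fin (j + 1))) (e : Fin (j + 1) → placesOver F₀ p), c j (e ∘ τ) = c j e)

/-! ## §1 Reading (P), `ln ν̄_{𝕃_p}` level: the junction under the room inequality (no bit) and under one bit -/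

/-- **READING (P) OVER PRINT's (Ind1)⊔(Ind2) AS TYPED EQUALS `−|log(Θ)|^{(P)}_p`, under the per-collection ROOM INEQUALITY, NO bit (modulo
`JannsenWingbergMappingClass`).**  Setting of p552192 §3 (every `v̲ ∣ p` of the section tame of odd local degree `≥ 3`; valuation family `v(i,v⃗)` of the Θ-idele at the last
slots; `H ≤ indTwo` containing the single-factor strip moves); the bit family REPLACED by R25 (A′) §1's room inequality at every collection:
`((v(i,v⃗) − 1) % e(v̲_j|p) + 2)/e(v̲_j|p) + Σ_{b ≠ j} 1/e(v̲_b|p) ≤ 1` — no residue hypothesis, no bit.  Then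
`ln ν̄_{𝕃_p}(v⃗ ↦ hull(⋃_{g ∈ H_{v⃗}} g(O_𝕃(−P_Θ)_{v⃗}))) = −|log(Θ)|^{(P)}_p`. [claim: Mochizuki2012, status: disputed]
[cite: Mochizuki2012, IUTchIII Thm. 3.11 (i) p. 154; Cor. 3.12 proof Step (x) p. 181] [cite: DupuyHilado2025, §4.9, §4.12] -/
theorem localFields_lnνLp_hull_orbitH_eq_negLogThetaPerImageAt_of_room_of_jannsenWingbergMappingClass
    (hMC : JannsenWingbergMappingClass) (hp2 : 2 < p) {lstar : ℕ}
    (t : Fin lstar → (v : placesOver F₀ p) → ((σ.localFields p).k v)ˣ)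
    (he : ∀ v : placesOver F₀ p, absRamificationIdx p ((σ.localFields p).k v) ≤ p - 2)
    (h3 : ∀ v : placesOver F₀ p, 3 ≤ localDeg K (σ.lift v.1)) (hodd : ∀ v : placesOver F₀ p, Odd (localDeg K (σ.lift v.1)))
    (v : (i : Fin lstar) → (Fin ((i : ℕ) + 1 + 1) → placesOver F₀ p) → ℤ)
    (hv : ∀ (i : Fin lstar) (e : Fin ((i : ℕ) + 1 + 1) → placesOver F₀ p),
      ‖(t i (e (Fin.last _)) : (σ.localFields p).k (e (Fin.last _)))‖ =
        (p : ℝ) ^ (-(v i e / (absRamificationIdx p ((σ.localFields p).k (e (Fin.last _))) : ℝ))))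
    (hroom : ∀ (i : Fin lstar) (e : Fin ((i : ℕ) + 1 + 1) → placesOver F₀ p),
      (((v i e - 1) % (absRamificationIdx p ((σ.localFields p).k (e (Fin.last _))) : ℤ) + 2 : ℤ) : ℝ) /
          (absRamificationIdx p ((σ.localFields p).k (e (Fin.last _))) : ℝ) +
        ∑ b ∈ Finset.univ.erase (Fin.last _), (1 : ℝ) / (absRamificationIdx p ((σ.localFields p).k (e b)) : ℝ) ≤ 1)
    (H : (j : ℕ) → (e : Fin (j + 1) → placesOver F₀ p) →
      Subgroup (PacketAlgebra p (fun b => (σ.localFields p).k (e b)) ≃ₗ[ℚ_[p]]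
        PacketAlgebra p (fun b => (σ.localFields p).k (e b))))
    (hH : ∀ j e, H j e ≤ indTwo p (fun b => (σ.localFields p).k (e b)))
    (hstrip : ∀ (i : Fin lstar) (e : Fin ((i : ℕ) + 1 + 1) → placesOver F₀ p) (b₀ : Fin ((i : ℕ) + 1 + 1)),
      ∀ ψ ∈ ind1StripOf (σ.lift (e b₀).1) (galoisLog (σ.lift (e b₀).1)), ∃ γ ∈ H ((i : ℕ) + 1) e,
        ∀ z : ∀ b, (σ.localFields p).k (e b),
          (γ : PacketAlgebra p (fun b => (σ.localFields p).k (e b)) ≃ₗ[ℚ_[p]]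
              PacketAlgebra p (fun b => (σ.localFields p).k (e b))) (PiTensorProduct.tprod ℚ_[p] z) =
            PiTensorProduct.tprod ℚ_[p] (update z b₀
              (RescaledCompletion.of K p (σ.lift (e b₀).1) (σ.natCast_mem_lift (e b₀))
                (ψ ((RescaledCompletion.of K p (σ.lift (e b₀).1) (σ.natCast_mem_lift (e b₀))).symm (z b₀)))))) :
    (realPrimePacketWith p (σ.localFields p) c hc0 hcσ).lnνLp lstar (fun j e =>
        packetHull p (fun b => (σ.localFields p).k (e b))
          (⋃ g : H j e, (g : PacketAlgebra p (fun b => (σ.localFields p).k (e b)) ≃ₗ[ℚ_[p]]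
              PacketAlgebra p (fun b => (σ.localFields p).k (e b))) ''
            (realPrimePacketWith p (σ.localFields p) c hc0 hcσ).pilotRegion t j e)) =
      (realPrimePacketWith p (σ.localFields p) c hc0 hcσ).negLogThetaPerImageAt lstar t := by
  refine realPrimePacketWith_lnνLp_hull_orbitH_eq_negLogThetaPerImageAt_of_forall_eq p (σ.localFields p) c hc0 hcσ t H fun i e => ?_
  have hcore := packetHull_iUnion_image_iota_smul_normalizedPacket_eq_of_room_of_jannsenWingbergMappingClass p
    (fun b => σ.lift (e b).1) (fun b => σ.natCast_mem_lift (e b)) hMC hp2 (fun b => he (e b)) (fun b => h3 (e b))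
    (fun b => hodd (e b)) (Fin.last _) (hv i e) (hroom i e) (H _ e) (hH _ e) (hstrip i e)
  obtain ⟨-, hcont⟩ := packetHull_iUnion_image_iota_smul_normalizedPacket_subset_of_tame p
    (fun b => σ.lift (e b).1) (fun b => σ.natCast_mem_lift (e b)) hp2 (fun b => he (e b)) (Fin.last _) (hv i e)
    (indTwo p (fun b => (σ.localFields p).k (e b))) le_rfl
  refine Set.Subset.antisymm ?_ ?_
  · exact packetHull_mono p _
      (realPrimePacketWith_orbitH_subset_slotImages p (σ.localFields p) c hc0 hcσ t i e (H _ e) (hH _ e))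
  · rw [realPrimePacketWith_slotImages_pilotRegion_eq,
      Set.iUnion_congr (fun γ => indTwo_smul_set p (fun b => (σ.localFields p).k (e b)) γ _),
      realPrimePacketWith_pilotRegion_succ_eq]
    refine hcont.trans (le_of_eq ?_)
    exact hcore.symm

/-- **READING (P) AS TYPED EQUALS `−|log(Θ)|^{(P)}_p`, under ONE BIT per collection (modulo `JannsenWingbergMappingClass`).**  As the previous theorem, with R25 (A′) §2's
one-bit form: at every collection a factor `b(i,v⃗)` is chosen; the room inequality `((v(i,v⃗) − 1) % e(v̲_j|p) + 1)/e(v̲_j|p) + Σ_{b′ ≠ b(i,v⃗)} 1/e(v̲_{b′}|p) ≤ 1`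
holds; and — only if `f(v̲_{b(i,v⃗)}|p) = 1` — some realised strip automorphism at `v̲_{b(i,v⃗)}` moves `ℤ_p·p` modulo `p·log_p(𝒪^×)`.
[claim: Mochizuki2012, status: disputed] [cite: Mochizuki2012, IUTchIII Thm. 3.11 (i) p. 154; Cor. 3.12 proof Step (x) p. 181] [cite: DupuyHilado2025, §4.9, §4.12] -/
theorem localFields_lnνLp_hull_orbitH_eq_negLogThetaPerImageAt_of_oneBit_of_jannsenWingbergMappingClass
    (hMC : JannsenWingbergMappingClass) (hp2 : 2 < p) {lstar : ℕ}
    (t : Fin lstar → (v : placesOver F₀ p) → ((σ.localFields p).k v)ˣ)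
    (he : ∀ v : placesOver F₀ p, absRamificationIdx p ((σ.localFields p).k v) ≤ p - 2)
    (h3 : ∀ v : placesOver F₀ p, 3 ≤ localDeg K (σ.lift v.1)) (hodd : ∀ v : placesOver F₀ p, Odd (localDeg K (σ.lift v.1)))
    (v : (i : Fin lstar) → (Fin ((i : ℕ) + 1 + 1) → placesOver F₀ p) → ℤ)
    (hv : ∀ (i : Fin lstar) (e : Fin ((i : ℕ) + 1 + 1) → placesOver F₀ p),
      ‖(t i (e (Fin.last _)) : (σ.localFields p).k (e (Fin.last _)))‖ =
        (p : ℝ) ^ (-(v i e / (absRamificationIdx p ((σ.localFields p).k (e (Fin.last _))) : ℝ))))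
    (b : (i : Fin lstar) → (Fin ((i : ℕ) + 1 + 1) → placesOver F₀ p) → Fin ((i : ℕ) + 1 + 1))
    (hroom : ∀ (i : Fin lstar) (e : Fin ((i : ℕ) + 1 + 1) → placesOver F₀ p),
      (((v i e - 1) % (absRamificationIdx p ((σ.localFields p).k (e (Fin.last _))) : ℤ) + 1 : ℤ) : ℝ) /
          (absRamificationIdx p ((σ.localFields p).k (e (Fin.last _))) : ℝ) +
        ∑ b' ∈ Finset.univ.erase (b i e), (1 : ℝ) / (absRamificationIdx p ((σ.localFields p).k (e b')) : ℝ) ≤ 1)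
    (hbit : ∀ (i : Fin lstar) (e : Fin ((i : ℕ) + 1 + 1) → placesOver F₀ p),
      (σ.lift (e (b i e)).1).asIdeal.inertiaDeg ℤ = 1 →
        ∃ ψ ∈ ind1StripOf (σ.lift (e (b i e)).1) (galoisLog (σ.lift (e (b i e)).1)),
          RescaledCompletion.of K p (σ.lift (e (b i e)).1) (σ.natCast_mem_lift (e (b i e))) (ψ (p : (σ.lift (e (b i e)).1).adicCompletion K)) -
              (p : RescaledCompletion K p (σ.lift (e (b i e)).1) (σ.natCast_mem_lift (e (b i e)))) ∉
            (p : ℚ_[p]) • logUnits (RescaledCompletion K p (σ.lift (e (b i e)).1) (σ.natCast_mem_lift (e (b i e)))))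
    (H : (j : ℕ) → (e : Fin (j + 1) → placesOver F₀ p) →
      Subgroup (PacketAlgebra p (fun b => (σ.localFields p).k (e b)) ≃ₗ[ℚ_[p]]
        PacketAlgebra p (fun b => (σ.localFields p).k (e b))))
    (hH : ∀ j e, H j e ≤ indTwo p (fun b => (σ.localFields p).k (e b)))
    (hstrip : ∀ (i : Fin lstar) (e : Fin ((i : ℕ) + 1 + 1) → placesOver F₀ p) (b₀ : Fin ((i : ℕ) + 1 + 1)),
      ∀ ψ ∈ ind1StripOf (σ.lift (e b₀).1) (galoisLog (σ.lift (e b₀).1)), ∃ γ ∈ H ((i : ℕ) + 1) e,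
        ∀ z : ∀ b, (σ.localFields p).k (e b),
          (γ : PacketAlgebra p (fun b => (σ.localFields p).k (e b)) ≃ₗ[ℚ_[p]]
              PacketAlgebra p (fun b => (σ.localFields p).k (e b))) (PiTensorProduct.tprod ℚ_[p] z) =
            PiTensorProduct.tprod ℚ_[p] (update z b₀
              (RescaledCompletion.of K p (σ.lift (e b₀).1) (σ.natCast_mem_lift (e b₀))
                (ψ ((RescaledCompletion.of K p (σ.lift (e b₀).1) (σ.natCast_mem_lift (e b₀))).symm (z b₀)))))) :
    (realPrimePacketWith p (σ.localFields p) c hc0 hcσ).lnνLp lstar (fun j e =>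
        packetHull p (fun b => (σ.localFields p).k (e b))
          (⋃ g : H j e, (g : PacketAlgebra p (fun b => (σ.localFields p).k (e b)) ≃ₗ[ℚ_[p]]
              PacketAlgebra p (fun b => (σ.localFields p).k (e b))) ''
            (realPrimePacketWith p (σ.localFields p) c hc0 hcσ).pilotRegion t j e)) =
      (realPrimePacketWith p (σ.localFields p) c hc0 hcσ).negLogThetaPerImageAt lstar t := by
  refine realPrimePacketWith_lnνLp_hull_orbitH_eq_negLogThetaPerImageAt_of_forall_eq p (σ.localFields p) c hc0 hcσ t H fun i e => ?_
  have hcore := packetHull_iUnion_image_iota_smul_normalizedPacket_eq_of_oneBit_of_jannsenWingbergMappingClass p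
    (fun b => σ.lift (e b).1) (fun b => σ.natCast_mem_lift (e b)) hMC hp2 (fun b => he (e b)) (fun b => h3 (e b))
    (fun b => hodd (e b)) (Fin.last _) (hv i e) (b i e) (hroom i e) (hbit i e) (H _ e) (hH _ e) (hstrip i e)
  obtain ⟨-, hcont⟩ := packetHull_iUnion_image_iota_smul_normalizedPacket_subset_of_tame p
    (fun b => σ.lift (e b).1) (fun b => σ.natCast_mem_lift (e b)) hp2 (fun b => he (e b)) (Fin.last _) (hv i e)
    (indTwo p (fun b => (σ.localFields p).k (e b))) le_rfl
  refine Set.Subset.antisymm ?_ ?_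
  · exact packetHull_mono p _
      (realPrimePacketWith_orbitH_subset_slotImages p (σ.localFields p) c hc0 hcσ t i e (H _ e) (hH _ e))
  · rw [realPrimePacketWith_slotImages_pilotRegion_eq,
      Set.iUnion_congr (fun γ => indTwo_smul_set p (fun b => (σ.localFields p).k (e b)) γ _),
      realPrimePacketWith_pilotRegion_succ_eq]
    refine hcont.trans (le_of_eq ?_)
    exact hcore.symm

/-! ## §2b Reading (U), place-section level: the slot union under the room inequality at the minimising slot -/

/-- **THE UNION JUNCTION under the ROOM INEQUALITY at the minimising slot, place-section level (modulo `JannsenWingbergMappingClass`).**  Setting of p553751 §2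
(collection `v⃗`, every factor tame of odd local degree `≥ 3`, slot valuations `‖t_{i,v_a}‖ = p^{−v_a/e(v̲_a|p)}`, content-minimising slot `a₀`, `H ≤ indTwo` containing
the single-factor (Ind1) strip moves); the bit family REPLACED by the room inequality at `a₀` — no residue hypothesis, no bit.  Same conclusion: the `(R_I)^∼`-hull of
the `H`-orbit of the (Ind1)-slot union EQUALS the hull of ALL possible images. [claim: Mochizuki2012, status: disputed]
[cite: Mochizuki2012, IUTchIII Thm. 3.11 (i) p. 154; Cor. 3.12 p. 174; IUTchIV Prop. 1.2 (ii) p. 10–11] [cite: DupuyHilado2025, §4.7, §4.9, §4.11, §4.12] -/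
theorem localFields_packetHull_orbitH_indOneUnion_pilotRegion_eq_possibleImagesHull_of_room_of_jannsenWingbergMappingClass
    (hMC : JannsenWingbergMappingClass) (hp2 : 2 < p) {lstar : ℕ}
    (t : Fin lstar → (v : placesOver F₀ p) → ((σ.localFields p).k v)ˣ) (i : Fin lstar)
    (e : Fin ((i : ℕ) + 1 + 1) → placesOver F₀ p)
    (he : ∀ b, absRamificationIdx p ((σ.localFields p).k (e b)) ≤ p - 2)
    (h3 : ∀ b, 3 ≤ localDeg K (σ.lift (e b).1)) (hodd : ∀ b, Odd (localDeg K (σ.lift (e b).1)))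
    (v : Fin ((i : ℕ) + 1 + 1) → ℤ)
    (hv : ∀ a, ‖(t i (e a) : (σ.localFields p).k (e a))‖ =
      (p : ℝ) ^ (-(v a / (absRamificationIdx p ((σ.localFields p).k (e a)) : ℝ))))
    (a₀ : Fin ((i : ℕ) + 1 + 1))
    (ha₀ : ∀ a, (v a₀ - 1) / (absRamificationIdx p ((σ.localFields p).k (e a₀)) : ℤ) ≤
      (v a - 1) / (absRamificationIdx p ((σ.localFields p).k (e a)) : ℤ))
    (hroom : (((v a₀ - 1) % (absRamificationIdx p ((σ.localFields p).k (e a₀)) : ℤ) + 2 : ℤ) : ℝ) /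
        (absRamificationIdx p ((σ.localFields p).k (e a₀)) : ℝ) +
      ∑ b ∈ Finset.univ.erase a₀, (1 : ℝ) / (absRamificationIdx p ((σ.localFields p).k (e b)) : ℝ) ≤ 1)
    (H : Subgroup (PacketAlgebra p (fun b => (σ.localFields p).k (e b)) ≃ₗ[ℚ_[p]]
      PacketAlgebra p (fun b => (σ.localFields p).k (e b))))
    (hH : H ≤ indTwo p (fun b => (σ.localFields p).k (e b)))
    (hstrip : ∀ (b₀ : Fin ((i : ℕ) + 1 + 1)),
      ∀ ψ ∈ ind1StripOf (σ.lift (e b₀).1) (galoisLog (σ.lift (e b₀).1)), ∃ γ ∈ H,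
        ∀ z : ∀ b, (σ.localFields p).k (e b),
          (γ : PacketAlgebra p (fun b => (σ.localFields p).k (e b)) ≃ₗ[ℚ_[p]]
              PacketAlgebra p (fun b => (σ.localFields p).k (e b))) (PiTensorProduct.tprod ℚ_[p] z) =
            PiTensorProduct.tprod ℚ_[p] (update z b₀
              (RescaledCompletion.of K p (σ.lift (e b₀).1) (σ.natCast_mem_lift (e b₀))
                (ψ ((RescaledCompletion.of K p (σ.lift (e b₀).1) (σ.natCast_mem_lift (e b₀))).symm (z b₀)))))) :
    packetHull p (fun b => (σ.localFields p).k (e b))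
        (⋃ γ : H, (γ : PacketAlgebra p (fun b => (σ.localFields p).k (e b)) ≃ₗ[ℚ_[p]]
            PacketAlgebra p (fun b => (σ.localFields p).k (e b))) ''
          ⋃ τ : Equiv.Perm (Fin ((i : ℕ) + 1 + 1)), (realPrimePacketWith p (σ.localFields p) c hc0 hcσ).perm τ e ''
            (realPrimePacketWith p (σ.localFields p) c hc0 hcσ).pilotRegion t ((i : ℕ) + 1) (e ∘ τ)) =
      (realPrimePacketWith p (σ.localFields p) c hc0 hcσ).possibleImagesHull
        ((realPrimePacketWith p (σ.localFields p) c hc0 hcσ).pilotRegion t) ((i : ℕ) + 1) e := by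
  have hcore := packetHull_iUnion_image_iUnion_iota_smul_normalizedPacket_eq_of_room_of_jannsenWingbergMappingClass p
    (fun b => σ.lift (e b).1) (fun b => σ.natCast_mem_lift (e b)) hMC hp2 he h3 hodd
    (fun a => (t i (e a) : (σ.localFields p).k (e a))) v hv a₀ ha₀ hroom H hH hstrip
  have hcont := TameContent.packetHull_orbit_iUnion_iota_smul_normalizedPacket_eq p (fun b => (σ.localFields p).k (e b)) hp2 he
    (fun a => (t i (e a) : (σ.localFields p).k (e a))) v hv
  have hU : (⋃ τ : Equiv.Perm (Fin ((i : ℕ) + 1 + 1)),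
      ((realPrimePacketWith p (σ.localFields p) c hc0 hcσ).perm τ e ''
          (realPrimePacketWith p (σ.localFields p) c hc0 hcσ).pilotRegion t ((i : ℕ) + 1) (e ∘ τ) :
        Set (PacketAlgebra p (fun b => (σ.localFields p).k (e b))))) =
      ⋃ a : Fin ((i : ℕ) + 1 + 1), iota p (fun b => (σ.localFields p).k (e b)) a (t i (e a) : (σ.localFields p).k (e a)) •
        (normalizedPacket p (fun b => (σ.localFields p).k (e b)) : Set (PacketAlgebra p (fun b => (σ.localFields p).k (e b)))) :=
    realPrimePacketWith_indOneUnion_pilotRegion_eq_slotUnion p (σ.localFields p) c hc0 hcσ t i e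
  change packetHull p _ (⋃ γ : H, (γ : PacketAlgebra p (fun b => (σ.localFields p).k (e b)) ≃ₗ[ℚ_[p]]
      PacketAlgebra p (fun b => (σ.localFields p).k (e b))) '' ⋃ τ : Equiv.Perm (Fin ((i : ℕ) + 1 + 1)),
      ((realPrimePacketWith p (σ.localFields p) c hc0 hcσ).perm τ e ''
          (realPrimePacketWith p (σ.localFields p) c hc0 hcσ).pilotRegion t ((i : ℕ) + 1) (e ∘ τ) :
        Set (PacketAlgebra p (fun b => (σ.localFields p).k (e b))))) =
    packetHull p _ ((realPrimePacketWith p (σ.localFields p) c hc0 hcσ).possibleImages _ _ e)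
  rw [hU, realPrimePacketWith_possibleImages_pilotRegion_eq]
  exact hcore.trans hcont.symm

end PlaceSection

end Summit.ABC.IUTFork.Thm311.Real
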